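/-
Copyright (c) 2026 the pub-hodgecm-mathlib formalisation cell (harness21).  Prover seat hodgecm-mathlib-K2Liu-p26 (g2): Track B «K2-LIT»,
#184♮ = hLiu418 = stmt-HodgeConjecture-24832; #42F′ FACE-G, organ F4 (G-gen), road (E) (RULING M-158r∕M-158u; F4 lead K2Liu-p27 (g2) DESK 23:42:50Z
«(E-d) PIVOT RESIDUE NAMED BY THE BYTE → p26 GO on (R-scal)»), brick (R-scal): THE SCALAR MATCH OF THE SEE-SAW PIVOT — `χ′(1 ⊗ k_σ) = η_t(y_k) · vacScalar(1,k)`.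
-/
import Summits.HodgeConjecture.HodgeConjecture.Theorems.K2LiuArchTensorKTypeCharacter          -- ★ `det_archAt_of_archUFormPi_eq_kV` (+ ★ PlacePinned `archUFormPi_placeSecJ_kV`, `det_coe_reindexUnitary`)
import Literature.NumberTheory.GelbartRogawski1991.DoubledWeilRepresentationArchHalfExplicit  -- ★ `etaD` (= `archDetZPow … fun v => (t (w v) + 1)/2`)
import Literature.NumberTheory.GaloisRepresentations.HeckeCharacterArchType                   -- ★ `HasUnitaryArchType`, `archUnitaryValue`
import Literature.Analysis.SegalBargmann.FockDualPairCompact                                  -- ★ `kronU`, `blockU`, `DPK`, `DPIdx`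
import Literature.RepresentationTheory.KonnoKonno2007.FockModelUnitaryDualPair                -- ★ `vacScalar`, `VacExponents`
import HarnessLib

/-!
# Crux `HLiu418`, organ F4 (G-gen), road (E), brick (R-scal): the scalar match closing the see-saw pivot letter `hpiv` —
# `(χ^m)(det k_σ) = η_t(placeSecJ σ (toBig (κ(1,k)), 1)) · vacScalar ⟨−|S|,−|R|,−|Q|,−|P|⟩ (1,k)` for `|P| = |Q| = m` (`Theorems/K2LiuRightLegVacuumScalarMatch.lean`)

Cell `hodgecm-mathlib`, crux item hLiu418 = `stmt-HodgeConjecture-24832`, route of record `HCCMUnconditional`; squad K2 ∕ K2Liu, road `K2_Liu`, socket #42F′,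
FACE-G ∕ organ F4 (G-gen); F4 lead K2Liu-p27 (g2) (desk word 23:42:50Z: exact head + exponent check); consumer LH7-p07 (g2) (B3-b assembly, letter (π3)).
THEOREMS ONLY (no `def`, no `instance`, no `notation`, no named-fact hypothesis, no `sorry`); lane `--supports stmt-HodgeConjecture-24832` (count-neutral helper).

WHY.  The (E-d) pivot `hpiv : SWσ (κOp R S e (1,k) v) = vacScalar e (1,k) • SWσ v` (★ `K2LiuLocalThetaReduction.hRED_of_pivot`'s only letter) is assembled
per place from (π0) ★ (P-arch) `K2LiuArchRightLegPlacePin.exists_clm_swSection_mul_placeSecJ_kH_eq` (scalar `η_t(y_k)`, `y_k := placeSecJ σ (toBig (κ(1,k)), 1)`,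
slot `κOp R S ⟨−|S|,−|R|,−|Q|,−|P|⟩ (1,k)`), (π1) (R-grp) `archEmb y_k = partnerEmb (k̂ σ k)`, (π2) ★ `K2LiuPartnerEmbeddingSWLaw.swSectionTensor_omega_partnerEmb_eq_mul`
(scalar `χ′(1 ⊗ k̂) = (χ^m)(det k̂)`, `m` = the small doubled half-dimension, ★ `siegelDeltaCharacter_partnerEmb`), and (π3) THIS FILE: the two scalars MATCH —
`(χ^m)(det k̂ σ k) = η_t(y_k) · vacScalar ⟨−|S|,−|R|,−|Q|,−|P|⟩ (1,k)` when `|P| = |Q| = m` (false otherwise).  Exponent check (F4 lead): with the unit-modulus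
`u := det k.1 · det k.2` and `χ_{w(σ)}(u) = u^{t}` (`χ.HasUnitaryArchType t 0`): LHS `u^{m t}`; `η_t(y_k) = det(y_{k,σ})^{(t+1)/2} = (u^{|P|+|Q|})^{(t+1)/2} = u^{m(t+1)}`;
`vacScalar = det c^{−|Q|} det d^{−|P|} = u^{−m}`; `u^{m(t+1)} · u^{−m} = u^{mt}` ✓ (`t` odd).  THIS FILE, k̂-FREE (the det datum enters as an infinite idele `x`
supported at `w(σ)` with value `u` — (R-grp)'s author discharges `GL.det (k̂ σ k) = infiniteIdeles L x`):
* §1 **`toBig_κ_eq_kV`** — `toBig (κ ((a,b),(c,d))) = kV (blockU (a ⊗ c, b ⊗ d), blockU (a ⊗ d, b ⊗ c))` (★ `coe_toBig`, ★ `reindex_kronecker_fromBlocks`), and the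
  determinants `det_coe_blockU_kronU`, **`det_bigKV_one`**: for `(1,(c,d))` the two blocks have `det K₁ · det K₂ = (det c · det d)^{|P|+|Q|}`;
* §2 GENERIC (any CM-type datum `F ⊂ E`, `c`, `wOf`, sign frames): **`coe_archDetZPow_placeSecJ_kV`** — `archDetZPow f (placeSecJ σ (kV K, 1)) = (det K.1 · det K.2)^{f σ}`
  (★ `archUFormPi_placeSecJ_kV`, ★ `det_archAt_of_archUFormPi_eq_kV`, ★ `coe_archDetZPow`, ★ `det_coe_reindexUnitary`);
* §3 GENERIC (any number field): **`heckeCharacter_infiniteIdeles_single`** — for `ψ.HasUnitaryArchType m 0` and an infinite idele `x` with `ι_{w₀}(x_{w₀}) = u`,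
  `‖u‖ = 1`, `ι_w(x_w) = 1` (`w ≠ w₀`): `ψ((x,1)) = u^{m_{w₀}}`; `heckeCharacter_pow_infiniteIdeles_single`;
* §4 `vacScalar_one_pair` (`vacScalar e (1,(c,d)) = det c^{e_R} det d^{e_S}`), `norm_det_unitary_mul` (`‖det c · det d‖ = 1`), and the exponent identity `zpow_pivot_exponent`;
* §5 HEAD **`chi_pow_det_eq_etaD_mul_vacScalar`** — the (R-scal) identity at the doubled CM datum `(e, dV, dW)` of ★ GR∕K2Lit (instantiate at the BIG datum
  `(e′, dV, tensorFrame dW eW dV′)` for the assembly), for EVERY real place `σ`, junction bijections `eP eQ`, `k : U(R) × U(S)`, `|P| = |Q| = m`.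
References: [KonnoKonno2007] §3.1 (3.1), Lemma 5.2 p. 73 (vacuum exponents); [Paul1998] §1.2 (1.2.1)–(1.2.2) p. 389 (the `det^{(t+1)/2}` twist); [Kudla1994] §3 Thm. 3.1
(the Siegel character on the Levi); [Folland1989] Prop. (4.39); [Patrikis2019] §2.1 (archimedean types).
HONEST LABEL.  Count-neutral helper; it retires nothing by itself: `HC_CM` is proved only modulo the 7 printed citations (2 remaining named inputs:
hLiu418 = `stmt-HodgeConjecture-24832`, h413 = `stmt-HodgeConjecture-24833`) until rung 0 closes.

## Tree search
★ `RealUnitaryDualPair` (`toBig`, `coe_toBig`, `κ`, `UForm.kV`, `UForm.coe_kV`, `reindex_kronecker_fromBlocks`, `JunctionWeilDatumGeneralRank.det_d_toBig_κ` — the `d`-block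
only); ★ `FockDualPairCompact` (`kronU`, `blockU`, `coe_kronU`, `coe_blockU`); ★ `K2LiuArchSectionPlacePinned` (`archUFormPi_placeSecJ_kV`, `det_coe_reindexUnitary`);
★ `K2LiuArchTensorKTypeCharacter` (`det_archAt_of_archUFormPi_eq_kV`, left-leg twin `coe_etaD_tensorEmb_of_kV`); ★ `UnitaryGroupArchDetZPow.coe_archDetZPow`;
★ `DoubledWeilRepresentationArchHalfExplicit.etaD`, `DoubledWeilRepresentationArchPlaceElement.coe_etaD_archKPlace` (pattern); ★ `HeckeCharacterArchType`
(`HasUnitaryArchType`, `archUnitaryValue`); Mathlib `norm_of_mem_unitary`, `Matrix.det_of_mem_unitary`, `Matrix.det_kronecker`, `Matrix.det_fromBlocks_zero₂₁`.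
Dedup `rg "placeSecJ.*toBig.*κ|etaD.*toBig|vacScalar.*etaD|infiniteIdeles.*archUnitaryValue" Summits/…/Theorems` — only ★ (P-arch) p863113 STATES `η_t(y_k)` (no value);
no file computes it or matches it with `vacScalar` (K2Liu-audit1 23:33:42Z + F4 lead 23:42:50Z: «owner wanted ∕ p26 GO»).
-/

set_option autoImplicit false
set_option linter.dupNamespace false -- the mandated namespace repeats `HodgeConjecture.HodgeConjecture`

noncomputable section

open scoped Matrix Kronecker Classical
open NumberField NumberField.InfinitePlace IsDedekindDomain

namespace Summit.HodgeConjecture.HodgeConjecture.Cruxes.HLiu418.K2LiuRightLegVacuumScalarMatch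

open Literature.NumberTheory.Automorphic Literature.NumberTheory.Automorphic.UnitaryGroup Literature.NumberTheory.Weil1964
open Literature.RepresentationTheory.KonnoKonno2007 Literature.RepresentationTheory.KonnoKonno2007.RealDualPair
open Literature.Analysis.SegalBargmann Literature.NumberTheory.GaloisRepresentations
open Summit.HodgeConjecture.HodgeConjecture.Cruxes.HLiu418.K2LiuArchSectionPlaceBlock
open Summit.HodgeConjecture.HodgeConjecture.Cruxes.HLiu418.K2LiuArchTensorKTypeCharacter

/-! ## §1 `toBig (κ k)` is sign-block compact; its block determinants -/

section BigBlocks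

variable {P Q R S : Type} [Fintype P] [DecidableEq P] [Fintype Q] [DecidableEq Q] [Fintype R] [DecidableEq R] [Fintype S] [DecidableEq S]

/-- **`toBig (κ ((a,b),(c,d))) = kV (diag(a ⊗ c, b ⊗ d), diag(a ⊗ d, b ⊗ c))`** — the image of the maximal compact `K_V × K_W` in the big group `U(P′,Q′)`,
`P′ = (P×R) ⊕ (Q×S)`, `Q′ = (P×S) ⊕ (Q×R)`, is sign-block diagonal (★ `coe_toBig`, ★ `reindex_kronecker_fromBlocks`, ★ `kronU`∕`blockU`).
[cite: KonnoKonno2007, §3.1 (3.1)] -/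
theorem toBig_κ_eq_kV (k : DPK P Q R S) :
    toBig P Q R S (κ P Q R S k) =
      UForm.kV ((P × R) ⊕ (Q × S)) ((P × S) ⊕ (Q × R))
        (blockU (kronU (k.1.1, k.2.1), kronU (k.1.2, k.2.2)), blockU (kronU (k.1.1, k.2.2), kronU (k.1.2, k.2.1))) := by
  refine Subtype.ext (Units.ext ?_)
  rw [coe_toBig, UForm.coe_kV, coe_blockU, coe_blockU, coe_kronU, coe_kronU, coe_kronU, coe_kronU]
  show Matrix.reindex (dpEquiv P Q R S) (dpEquiv P Q R S)
      ((((UForm.kV P Q k.1 : UForm P Q) : GL (P ⊕ Q) ℂ) : Matrix (P ⊕ Q) (P ⊕ Q) ℂ) ⊗ₖ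
        (((UForm.kV R S k.2 : UForm R S) : GL (R ⊕ S) ℂ) : Matrix (R ⊕ S) (R ⊕ S) ℂ)) = _
  rw [UForm.coe_kV, UForm.coe_kV, reindex_kronecker_fromBlocks]

/-- `det (diag(a ⊗ c, b ⊗ d)) = (det a^{|R|} det c^{|P|}) · (det b^{|S|} det d^{|Q|})` (`Matrix.det_fromBlocks_zero₂₁`, `Matrix.det_kronecker`). [folklore] -/
theorem det_coe_blockU_kronU (a : Matrix.unitaryGroup P ℂ) (b : Matrix.unitaryGroup Q ℂ) (c : Matrix.unitaryGroup R ℂ) (d : Matrix.unitaryGroup S ℂ) :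
    ((blockU (kronU (a, c), kronU (b, d)) : Matrix.unitaryGroup ((P × R) ⊕ (Q × S)) ℂ) : Matrix ((P × R) ⊕ (Q × S)) ((P × R) ⊕ (Q × S)) ℂ).det =
      ((a : Matrix P P ℂ).det ^ Fintype.card R * (c : Matrix R R ℂ).det ^ Fintype.card P) *
        ((b : Matrix Q Q ℂ).det ^ Fintype.card S * (d : Matrix S S ℂ).det ^ Fintype.card Q) := by
  rw [coe_blockU, coe_kronU, coe_kronU, Matrix.det_fromBlocks_zero₂₁, Matrix.det_kronecker, Matrix.det_kronecker]

/-- **the two block determinants of `toBig (κ (1,(c,d)))` multiply to `(det c · det d)^{|P|+|Q|}`**. [cite: KonnoKonno2007, Lemma 5.2 p. 73] -/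
theorem det_bigKV_one (c : Matrix.unitaryGroup R ℂ) (d : Matrix.unitaryGroup S ℂ) :
    ((blockU (kronU ((1 : Matrix.unitaryGroup P ℂ), c), kronU ((1 : Matrix.unitaryGroup Q ℂ), d)) : Matrix.unitaryGroup ((P × R) ⊕ (Q × S)) ℂ) :
        Matrix ((P × R) ⊕ (Q × S)) ((P × R) ⊕ (Q × S)) ℂ).det *
      ((blockU (kronU ((1 : Matrix.unitaryGroup P ℂ), d), kronU ((1 : Matrix.unitaryGroup Q ℂ), c)) : Matrix.unitaryGroup ((P × S) ⊕ (Q × R)) ℂ) :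
        Matrix ((P × S) ⊕ (Q × R)) ((P × S) ⊕ (Q × R)) ℂ).det =
      ((c : Matrix R R ℂ).det * (d : Matrix S S ℂ).det) ^ (Fintype.card P + Fintype.card Q) := by
  rw [det_coe_blockU_kronU, det_coe_blockU_kronU]
  simp only [OneMemClass.coe_one, Matrix.det_one, one_pow, one_mul]
  ring

end BigBlocks

/-! ## §2 Generic: the `det`-power character at `placeSecJ σ (kV K, 1)` -/

section Generic

variable {F : Type} [Field F] [NumberField F] (E : Type) [Field E] [NumberField E] [Algebra F E] (c : E ≃ₐ[F] E)
  (N : ℕ) (hc : c ≠ 1)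
  (wOf : {v : InfinitePlace F // v.IsReal} → {w : InfinitePlace E // w.IsComplex})
  (hw : ∀ v, c • (wOf v).1 = (wOf v).1) (t₀ : Fin N → F) (ht0 : ∀ j, t₀ j ≠ 0) {δ : E} (hcδ : c δ = -δ) (hδ : δ ≠ 0)
  (σ : {v : InfinitePlace F // v.IsReal})
  (hover : ∀ v, (wOf v).1.comap (algebraMap F E) = v.1) {T : Matrix (Fin N) (Fin N) F} (hTd : T = Matrix.diagonal t₀)
  {J : Matrix (Fin N) (Fin N) E} (hJ : J = T.map (algebraMap F E)) (hfix : ∀ w : InfinitePlace E, c • w = w)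
  {P' Q' : Type} [Fintype P'] [DecidableEq P'] [Fintype Q'] [DecidableEq Q']
  (eP : PosIdx (signVec wOf t₀ δ σ) ≃ P') (eQ : NegIdx (signVec wOf t₀ δ σ) ≃ Q')

/-- **THE `det`-POWER CHARACTER AT A ONE-PLACE COMPACT SECTION**: `archDetZPow f (placeSecJ σ (kV (K₁,K₂), 1)) = (det K₁ · det K₂)^{f σ}` — only the place `σ`
contributes (★ `archUFormPi_placeSecJ_kV`: the `σ`-component is `kV (K₁^{eP}, K₂^{eQ})`, the others are `kV (1,1)`; ★ `det_archAt_of_archUFormPi_eq_kV`).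
[cite: Paul1998, §1.2 (1.2.2) p. 389] [cite: BorelJacquet1979, §4.1] -/
theorem coe_archDetZPow_placeSecJ_kV (f : {v : InfinitePlace F // v.IsReal} → ℤ) (K : Matrix.unitaryGroup P' ℂ × Matrix.unitaryGroup Q' ℂ) :
    ((archDetZPow F E c N J hc wOf hw f
        (placeSecJ E c N hc wOf hw t₀ ht0 hcδ hδ σ hover hTd hJ hfix eP eQ ((UForm.kV P' Q' K, (1 : UForm Unit Empty)) : Ginf P' Q' Unit Empty)) : ℂˣ) : ℂ) =
      ((K.1 : Matrix P' P' ℂ).det * (K.2 : Matrix Q' Q' ℂ).det) ^ f σ := by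
  rw [coe_archDetZPow, Finset.prod_eq_single σ]
  · rw [det_archAt_of_archUFormPi_eq_kV E c N hc wOf hw hover t₀ ht0 hTd hJ hcδ hδ _ σ (reindexUnitary eP K.1, reindexUnitary eQ K.2)
      (by rw [archUFormPi_placeSecJ_kV, Function.update_self, Function.update_self]), det_coe_reindexUnitary, det_coe_reindexUnitary]
  · intro v _ hv
    rw [det_archAt_of_archUFormPi_eq_kV E c N hc wOf hw hover t₀ ht0 hTd hJ hcδ hδ _ v (1, 1)
      (by rw [archUFormPi_placeSecJ_kV, Function.update_of_ne hv, Function.update_of_ne hv, Pi.one_apply, Pi.one_apply]),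
      OneMemClass.coe_one, OneMemClass.coe_one, Matrix.det_one, Matrix.det_one, mul_one, one_zpow]
  · intro h; exact absurd (Finset.mem_univ σ) h

end Generic

/-! ## §3 Generic: a unitary Hecke character of archimedean type `(m, 0)` at an infinite idele supported at one place -/

section Character

variable {K : Type} [Field K] [NumberField K]

/-- `archUnitaryValue m 0 1 = 1`. [folklore] -/
theorem archUnitaryValue_zero_one (m : ℤ) : archUnitaryValue m 0 (1 : ℂ) = 1 := by
  unfold archUnitaryValue
  rw [norm_one, Complex.ofReal_one, div_one, one_zpow, one_mul, Complex.ofReal_zero, zero_mul, Complex.cpow_zero]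

/-- `archUnitaryValue m 0 u = u^m` for `‖u‖ = 1`. [folklore] -/
theorem archUnitaryValue_zero_of_norm_eq_one (m : ℤ) {u : ℂ} (hu : ‖u‖ = 1) : archUnitaryValue m 0 u = u ^ m := by
  unfold archUnitaryValue
  rw [hu, Complex.ofReal_one, div_one, Complex.ofReal_zero, zero_mul, Complex.cpow_zero, mul_one]

/-- **A UNITARY HECKE CHARACTER OF ARCHIMEDEAN TYPE `(m, 0)` AT A ONE-PLACE INFINITE IDELE**: if the infinite idele `x` has `ι_{w₀}(x_{w₀}) = u` with `‖u‖ = 1` and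
`ι_w(x_w) = 1` for `w ≠ w₀`, then `ψ((x, 1)) = u^{m_{w₀}}`. [cite: Patrikis2019, §2.1] -/
theorem heckeCharacter_infiniteIdeles_single (ψ : HeckeCharacter K) {m : InfinitePlace K → ℤ} (hψ : ψ.HasUnitaryArchType m 0) (w₀ : InfinitePlace K)
    (x : (InfiniteAdeleRing K)ˣ) {u : ℂ} (hu : ‖u‖ = 1)
    (hx₀ : InfinitePlace.Completion.extensionEmbedding w₀ ((x : InfiniteAdeleRing K) w₀) = u)
    (hx : ∀ w, w ≠ w₀ → InfinitePlace.Completion.extensionEmbedding w ((x : InfiniteAdeleRing K) w) = 1) :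
    (ψ (infiniteIdeles K x) : ℂ) = u ^ m w₀ := by
  rw [hψ x, Finset.prod_eq_single w₀]
  · rw [hx₀, Pi.zero_apply, archUnitaryValue_zero_of_norm_eq_one _ hu]
  · intro w _ hw0
    rw [hx w hw0, Pi.zero_apply, archUnitaryValue_zero_one]
  · intro h; exact absurd (Finset.mem_univ w₀) h

/-- … and for a power of the character: `(ψ^k)((x,1)) = (u^{m_{w₀}})^k`. [cite: Patrikis2019, §2.1] -/
theorem heckeCharacter_pow_infiniteIdeles_single (ψ : HeckeCharacter K) {m : InfinitePlace K → ℤ} (hψ : ψ.HasUnitaryArchType m 0) (w₀ : InfinitePlace K)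
    (x : (InfiniteAdeleRing K)ˣ) {u : ℂ} (hu : ‖u‖ = 1)
    (hx₀ : InfinitePlace.Completion.extensionEmbedding w₀ ((x : InfiniteAdeleRing K) w₀) = u)
    (hx : ∀ w, w ≠ w₀ → InfinitePlace.Completion.extensionEmbedding w ((x : InfiniteAdeleRing K) w) = 1) (k : ℕ) :
    (((ψ ^ k) (infiniteIdeles K x) : ℂˣ) : ℂ) = (u ^ m w₀) ^ k := by
  rw [HeckeCharacter.pow_apply, Units.val_pow_eq_pow_val, heckeCharacter_infiniteIdeles_single ψ hψ w₀ x hu hx₀ hx]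

end Character

/-! ## §4 The vacuum scalar on the right-leg compact, unit modulus of `det`, and the exponent identity -/

section Scalars

variable {P Q R S : Type} [Fintype P] [DecidableEq P] [Fintype Q] [DecidableEq Q] [Fintype R] [DecidableEq R] [Fintype S] [DecidableEq S]

/-- **`vacScalar e (1,(c,d)) = det c^{e_R} · det d^{e_S}`** (the `K_V`-factors are `det 1 = 1`). [cite: KonnoKonno2007, Lemma 5.2 p. 73] -/
theorem vacScalar_one_pair (e : VacExponents) (k : Matrix.unitaryGroup R ℂ × Matrix.unitaryGroup S ℂ) :
    vacScalar e (((1 : Matrix.unitaryGroup P ℂ × Matrix.unitaryGroup Q ℂ), k) : DPK P Q R S) =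
      (k.1 : Matrix R R ℂ).det ^ e.eR * (k.2 : Matrix S S ℂ).det ^ e.eS := by
  unfold vacScalar
  rw [show (((1 : Matrix.unitaryGroup P ℂ × Matrix.unitaryGroup Q ℂ), k) : DPK P Q R S).1.1 = 1 from rfl,
    show (((1 : Matrix.unitaryGroup P ℂ × Matrix.unitaryGroup Q ℂ), k) : DPK P Q R S).1.2 = 1 from rfl, OneMemClass.coe_one, OneMemClass.coe_one,
    Matrix.det_one, Matrix.det_one, one_zpow, one_zpow, one_mul, one_mul]

/-- the determinant of a unitary matrix has modulus `1`. [folklore] -/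
theorem norm_det_coe_unitaryGroup (c : Matrix.unitaryGroup P ℂ) : ‖(c : Matrix P P ℂ).det‖ = 1 :=
  CStarRing.norm_of_mem_unitary (Matrix.det_of_mem_unitary c.2)

/-- `‖det c · det d‖ = 1`. [folklore] -/
theorem norm_det_unitary_mul (c : Matrix.unitaryGroup R ℂ) (d : Matrix.unitaryGroup S ℂ) :
    ‖(c : Matrix R R ℂ).det * (d : Matrix S S ℂ).det‖ = 1 := by
  rw [norm_mul, norm_det_coe_unitaryGroup, norm_det_coe_unitaryGroup, mul_one]

/-- **THE EXPONENT IDENTITY OF THE PIVOT**: for `u ≠ 0`, `t = 2r + 1` odd and `m : ℕ`, `(u^t)^m = (u^{m+m})^{(t+1)/2} · u^{−m}` — i.e. `mt = 2m·(r+1) − m`.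
[cite: KonnoKonno2007, Lemma 5.2 p. 73] [cite: Paul1998, §1.2 (1.2.2)] -/
theorem zpow_pivot_exponent {u : ℂ} (hu : u ≠ 0) {t : ℤ} (hodd : Odd t) (m : ℕ) :
    (u ^ t) ^ m = (u ^ (m + m)) ^ ((t + 1) / 2) * u ^ (-(m : ℤ)) := by
  obtain ⟨r, hr⟩ := hodd
  have ht : (t + 1) / 2 = r + 1 := by omega
  rw [ht, ← zpow_natCast (u ^ t) m, ← zpow_mul, ← zpow_natCast u (m + m), ← zpow_mul, ← zpow_add₀ hu]
  congr 1
  push_cast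
  rw [hr]
  ring

end Scalars

/-! ## §5 The scalar match at the doubled CM datum -/

section CMDatum

open Literature.NumberTheory.GelbartRogawski1991 Literature.NumberTheory.GelbartRogawski1991.GRConstruction
open Literature.NumberTheory.GelbartRogawski1991.UnitaryDualPair Literature.NumberTheory.GelbartRogawski1991.UnitaryDualPair.LocalSplitting
open Literature.RepresentationTheory.HarrisKudlaSweet1996

variable (L : Type) [Field L] [NumberField L] [IsCMField L]
variable {N M n : ℕ} (e : Fin N × Fin M ≃ Fin n)
  (dV : Fin N → L) (hdV : ∀ i, IsCMField.complexConj L (dV i) = dV i) (hdV0 : ∀ i, dV i ≠ 0)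
  (dW : Fin M → L) (hdW : ∀ i, IsCMField.complexConj L (dW i) = dW i) (hdW0 : ∀ i, dW i ≠ 0)
variable (σ : {v : InfinitePlace (Fp L) // v.IsReal})
  {P Q R S : Type} [Fintype P] [DecidableEq P] [Fintype Q] [DecidableEq Q] [Fintype R] [DecidableEq R] [Fintype S] [DecidableEq S]
  (eP : PosIdx (signVec (cmPlaceOver L) (fun k => Sum.elim (cmGramEntry L e dV hdV dW hdW) (-cmGramEntry L e dV hdV dW hdW) ((LocalSplitting.e₂ n).symm k))
    (imagUnit L) σ) ≃ (P × R) ⊕ (Q × S))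
  (eQ : NegIdx (signVec (cmPlaceOver L) (fun k => Sum.elim (cmGramEntry L e dV hdV dW hdW) (-cmGramEntry L e dV hdV dW hdW) ((LocalSplitting.e₂ n).symm k))
    (imagUnit L) σ) ≃ (P × S) ⊕ (Q × R))

include hdV0 hdW0 in
/-- **`η_t(placeSecJ σ (toBig (κ (1,k)), 1)) = ((det c · det d)^{|P|+|Q|})^{(t_{w(σ)}+1)/2}`** at the doubled CM datum `(e, dV, dW)` (instantiate at the big datum
`(e′, dV, tensorFrame …)` for the (E-d) pivot): §2 with `f v = (t (w v) + 1)/2` and §1. [cite: Paul1998, §1.2 (1.2.1)–(1.2.2) p. 389] [cite: KonnoKonno2007, Lemma 5.2 p. 73] -/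
theorem coe_etaD_placeSecJ_toBig_κ_one (t : InfinitePlace L → ℤ) (k : Matrix.unitaryGroup R ℂ × Matrix.unitaryGroup S ℂ) :
    ((etaD L e dV hdV dW hdW t
        (placeSecJ L (IsCMField.complexConj L) (n + n) (IsCMField.complexConj_ne_one L) (cmPlaceOver L) (cmPlaceOver_smul L) _
          (gramD_gram_realDiagonal_entry_ne_zero L e dV hdV dW hdW hdV0 hdW0) (complexConj_imagUnit L) (imagUnit_ne_zero L) σ
          (cmPlaceOver_comap L) (gramD_eq_diagonal_cm L e dV hdV dW hdW) (J := hermD L e dV hdV dW hdW) rfl (complexConj_smul_infinitePlace L) eP eQ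
          ((toBig P Q R S (κ P Q R S ((1 : Matrix.unitaryGroup P ℂ × Matrix.unitaryGroup Q ℂ), k)), (1 : UForm Unit Empty)) :
            Ginf ((P × R) ⊕ (Q × S)) ((P × S) ⊕ (Q × R)) Unit Empty)) : ℂˣ) : ℂ) =
      (((k.1 : Matrix R R ℂ).det * (k.2 : Matrix S S ℂ).det) ^ (Fintype.card P + Fintype.card Q)) ^ ((t (cmPlaceOver L σ).1 + 1) / 2) := by
  rw [etaD, toBig_κ_eq_kV, coe_archDetZPow_placeSecJ_kV, ← det_bigKV_one]
  rfl

include hdV0 hdW0 in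
/-- **(R-scal) — THE SCALAR MATCH OF THE SEE-SAW PIVOT** (F4 lead 23:42:50Z head, k̂-free form): for `χ` of odd unitary archimedean type `(t, 0)`, `|P| = |Q| = m`,
`k = (c,d) ∈ U(R) × U(S)`, and any infinite idele `x` supported at `w(σ)` with `ι_{w(σ)}(x_{w(σ)}) = det c · det d` (the determinant of the right-leg partner `1 ⊗ k_σ`;
`ι_w(x_w) = 1` for `w ≠ w(σ)`):
`(χ^m)((x,1)) = η_t(placeSecJ σ (toBig (κ (1,k)), 1)) · vacScalar ⟨−|S|,−|R|,−|Q|,−|P|⟩ (1,k)` — exponents `m t = m(t+1) − m`.  With (R-grp) `GL.det (k̂ σ k) = (x,1)` this is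
letter (π3) of the pivot chain: `hpiv` for ★ `K2LiuLocalThetaReduction.hRED_of_pivot` follows from ★ (P-arch) ∘ (R-grp) ∘ ★ SW-law ∘ this.
[cite: KonnoKonno2007, Lemma 5.2 p. 73] [cite: Paul1998, §1.2 (1.2.1)–(1.2.2) p. 389] [cite: Kudla1994, §3 Thm. 3.1] -/
theorem chi_pow_infiniteIdeles_eq_etaD_mul_vacScalar {χ : HeckeCharacter L} {t : InfinitePlace L → ℤ} (ht : χ.HasUnitaryArchType t 0)
    (hodd : ∀ w, Odd (t w)) (m : ℕ) (hP : Fintype.card P = m) (hQ : Fintype.card Q = m) (k : Matrix.unitaryGroup R ℂ × Matrix.unitaryGroup S ℂ)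
    (x : (InfiniteAdeleRing L)ˣ)
    (hxσ : InfinitePlace.Completion.extensionEmbedding (cmPlaceOver L σ).1 ((x : InfiniteAdeleRing L) (cmPlaceOver L σ).1) =
      (k.1 : Matrix R R ℂ).det * (k.2 : Matrix S S ℂ).det)
    (hx : ∀ w, w ≠ (cmPlaceOver L σ).1 → InfinitePlace.Completion.extensionEmbedding w ((x : InfiniteAdeleRing L) w) = 1) :
    (((χ ^ m) (infiniteIdeles L x) : ℂˣ) : ℂ) =
      ((etaD L e dV hdV dW hdW t
          (placeSecJ L (IsCMField.complexConj L) (n + n) (IsCMField.complexConj_ne_one L) (cmPlaceOver L) (cmPlaceOver_smul L) _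
            (gramD_gram_realDiagonal_entry_ne_zero L e dV hdV dW hdW hdV0 hdW0) (complexConj_imagUnit L) (imagUnit_ne_zero L) σ
            (cmPlaceOver_comap L) (gramD_eq_diagonal_cm L e dV hdV dW hdW) (J := hermD L e dV hdV dW hdW) rfl (complexConj_smul_infinitePlace L) eP eQ
            ((toBig P Q R S (κ P Q R S ((1 : Matrix.unitaryGroup P ℂ × Matrix.unitaryGroup Q ℂ), k)), (1 : UForm Unit Empty)) :
              Ginf ((P × R) ⊕ (Q × S)) ((P × S) ⊕ (Q × R)) Unit Empty)) : ℂˣ) : ℂ) *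
        vacScalar (⟨-(Fintype.card S : ℤ), -(Fintype.card R : ℤ), -(Fintype.card Q : ℤ), -(Fintype.card P : ℤ)⟩ : VacExponents)
          (((1 : Matrix.unitaryGroup P ℂ × Matrix.unitaryGroup Q ℂ), k) : DPK P Q R S) := by
  have hu1 : ‖(k.1 : Matrix R R ℂ).det * (k.2 : Matrix S S ℂ).det‖ = 1 := norm_det_unitary_mul k.1 k.2
  have hu : (k.1 : Matrix R R ℂ).det * (k.2 : Matrix S S ℂ).det ≠ 0 := fun h => by
    rw [h, norm_zero] at hu1
    exact zero_ne_one hu1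
  rw [heckeCharacter_pow_infiniteIdeles_single χ ht (cmPlaceOver L σ).1 x hu1 hxσ hx m,
    coe_etaD_placeSecJ_toBig_κ_one L e dV hdV hdV0 dW hdW hdW0 σ eP eQ t k, vacScalar_one_pair, hP, hQ,
    zpow_pivot_exponent hu (hodd _) m, mul_zpow]

end CMDatum

end Summit.HodgeConjecture.HodgeConjecture.Cruxes.HLiu418.K2LiuRightLegVacuumScalarMatch

end
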